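import Literature.AlgebraicGeometry.Resolution.AlterationsSemiStableCodimTwoProofs
import Literature.RingTheory.FittingIdeal.Basic
import Mathlib.RingTheory.Kaehler.Basic
import Mathlib.RingTheory.Length
import HarnessLib

/-!
# De Jong's alteration theorem: the invariants `n_T` and the Claim of 3.4 (de Jong 1996, 2.21, 3.3–3.4)

Topic: `Literature/AlgebraicGeometry/Resolution`. Second layer of the decomposition of de Jong
1996, Lemma 3.2 (`DeJong1996Lemma32`, `AlterationsLemma32.lean`), below
`AlterationsSemiStableCodimTwo.lean` / `AlterationsSemiStableCodimTwoProofs.lean`, which left the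
single named fact `DeJong1996SemiStableCodimTwoModification` — the Claim of 3.4 ITERATED along
one codimension-2 component `T` of `Sing(X)` ("by repeatedly blowing up components of the
singular locus of codimension 2 in `X` and induction on the numbers `n_T`"). This file cuts that
fact into the two printed ingredients of the iteration and proves the iteration:

* the **invariant `n_T`** (3.3–3.4) is rendered INTRINSICALLY, through the scheme structure that
  2.21 puts on the singular locus of `f` ("Let `Sing(f) ⊂ X` be the closed subscheme defined by
  the first Fitting ideal of the sheaf `Ω_{X/S}`"): `Scheme.Hom.singFittingIdeal f x ⊆ 𝒪_{X,x}`
  is the first Fitting ideal (`Literature.RingTheory.FittingIdeal.Module.fittingIdeal`) of the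
  Kähler differentials `Ω_{𝒪_{X,x}/𝒪_{Y,f x}}` — the stalk at `x` of the ideal of `Sing(f)`,
  Fitting ideals and differentials commuting with localization — and
  `Scheme.Hom.nodeThickness f x = ℓ(𝒪_{X,x}/Fitt₁) ∈ ℕ∞` is the length of the local ring of
  `Sing(f)` at `x`. At the generic point `ξ_T` of a codimension-2 component `T` of `Sing(X)` this
  is de Jong's `n_T`: by 3.3 "the trace of `Sing(f)` on `Spec B` is given by the ideal
  `(u, v) ⊂ B`" (indeed `Fitt₁` of `Ω_{B/A'} = (B du ⊕ B dv)/(Q_u du + Q_v dv)` is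
  `(Q_u, Q_v) = (u, v)`, `disc(Q)` being a unit), so `𝒪_{Sing(f)} ≅ A'/(h) = A'/(t₁^{n₁} ⋯ t_r^{n_r})`
  near a point of `T`, and by 3.4 "the complete local ring of `T` at `x` corresponds to the
  quotient map `B → A'/t₁A'`", so that at `ξ_T` the local ring of `Sing(f)` is
  `A'_{(t₁)}/(t₁^{n₁})`, of length `n₁ = n_T`;
* `DeJong1996SemiStableThickness` — NAMED FACT, **3.4: "The integer `n_T` must be `≥ 2` … it is
  an invariant `n_T` of the codimension 2 irreducible component `T` of `Sing(X)`"**: for a pair in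
  Situation 4.23 and a codimension-`≤ 2` singular point `x` (the generic point of such a `T`),
  `2 ≤ nodeThickness f x < ∞`;
* `DeJong1996SemiStableCodimTwoBlowup` — NAMED FACT, **the Claim of 3.4 for ONE blow-up**: for
  the blowing up `π : X' → X` of `X` in the ideal sheaf of `T = cl{x}` (reduced structure):
  (ii) `π ≫ f` is a semi-stable curve smooth over `Y ∖ D`; (iii) `π` maps the codimension-`≤ 2`
  singular points of `X'` injectively to those of `X` ("There exists at most one such
  irreducible component `T̃ ⊂ Sing(X')` lying above `T'`"), with `n_T̃ = n_{T'}` for `T' ≠ T`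
  and `n_T̃ = n_T - 2` over `T` ((i), the centre, is automatic for a blow-up of `T ⊆ Sing(X)`;
  (iv) is not rendered);
* PROVED: `DeJong1996SemiStableCodimTwoModification.of_thickness_of_blowup` — the iteration along
  one component ("induction on the numbers `n_T`"): by induction on `n_T`, blow up `T`; if no
  codimension-2 singular component of `X'` lies over `T`, stop; otherwise it is unique, with
  invariant `n_T - 2`, the new curve is again the curve of a pair in Situation 4.23 (the
  sections lift, `SemiStablePair.exists_lift`, and `X'` is projective, `BlowupProjectiveOverField`),
  so the induction hypothesis applies to it, and the two modifications compose; whence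
  `DeJong1996Lemma32.of_thickness_of_blowup` and
  `DeJong1996SemiStableCodimThree.of_thickness_of_blowup`.

## Sources

* A. J. de Jong, *Smoothness, semi-stability and alterations*, Publ. Math. IHÉS 83 (1996), 2.21
  (p. 61), 3.1–3.4 (pp. 62–64), 4.23–4.24 (p. 75).
* D. Eisenbud, *Commutative Algebra*, GTM 150 (1995), §20.2 (Fitting ideals; Cor. 20.5:
  compatibility with base change).
* R. Hartshorne, *Algebraic Geometry* (1977), II Prop. 7.16 (c), via `BlowupProjectiveOverField`.
-/

noncomputable section

open CategoryTheory CategoryTheory.Limits AlgebraicGeometry TopologicalSpace IsLocalRing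

namespace Literature.AlgebraicGeometry.Resolution

universe u

/-! ## The singular scheme of a morphism at a point and the thickness `n_T` -/

/-- **The stalk at `x` of the ideal of the singular scheme `Sing(f)`** (de Jong 1996, 2.21:
"Let `Sing(f) ⊂ X` be the closed subscheme defined by the first Fitting ideal of the sheaf
`Ω_{X/S}`"): the first Fitting ideal of the module of Kähler differentials of
`𝒪_{Y, f x} → 𝒪_{X, x}` (Fitting ideals and Kähler differentials commute with localization,
Eisenbud Cor. 20.5, so this is the stalk of `Fitt₁(Ω_{X/Y})`). [cite: DeJong1996, 2.21, p. 61] -/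
def Scheme.Hom.singFittingIdeal {X Y : Scheme.{u}} (f : X ⟶ Y) (x : X) :
    Ideal (X.presheaf.stalk x) :=
  letI : Algebra (Y.presheaf.stalk (f x)) (X.presheaf.stalk x) := (f.stalkMap x).hom.toAlgebra
  Literature.RingTheory.FittingIdeal.Module.fittingIdeal (X.presheaf.stalk x)
    (KaehlerDifferential (Y.presheaf.stalk (f x)) (X.presheaf.stalk x)) 1

/-- **The thickness of `f` at `x`**: the length `ℓ(𝒪_{X,x}/Fitt₁(Ω)) ∈ ℕ∞` of the local ring
at `x` of the singular scheme `Sing(f)` of 2.21 (`⊤` if infinite, `0` off `Sing(f)`). For a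
semi-stable curve `f : X → S` as in de Jong 1996, 3.1 and the generic point `ξ_T` of an
irreducible component `T` of `Sing(X)` of codimension `2`, this is the invariant `n_T` of 3.4:
by 3.3 the trace of `Sing(f)` on `Spec B`, `B = 𝒪̂_{X,x} ≅ A'⟦u, v⟧/(Q - t₁^{n₁} ⋯ t_r^{n_r})`, is
`V(u, v) ≅ Spec A'/(t₁^{n₁} ⋯ t_r^{n_r})`, and `T` corresponds to `B → A'/t₁A'` (3.4), so the
local ring of `Sing(f)` at `ξ_T` is `A'_{(t₁)}/(t₁^{n₁})`, of length `n₁ = n_T`.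
[cite: DeJong1996, 3.3–3.4, pp. 63] -/
def Scheme.Hom.nodeThickness {X Y : Scheme.{u}} (f : X ⟶ Y) (x : X) : ℕ∞ :=
  Module.length (X.presheaf.stalk x) (X.presheaf.stalk x ⧸ Scheme.Hom.singFittingIdeal f x)

/-! ## 3.4 as two named facts: the invariant, and the Claim for one blow-up -/

/-- NAMED FACT — **de Jong 1996, 3.4: the invariant `n_T ≥ 2` of a codimension-2 component of
the singular locus.** Setting 3.1 (`S` excellent regular, `D ⊂ S` a strict normal crossings
divisor, `f : X → S` semi-stable, smooth over `S ∖ D`), `T` an irreducible component of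
`Sing(X)` of codimension `2` in `X`: "if `x ∈ T ⊂ X` and we write the complete local ring `B`
of `X` in `x` as in 3.3 [`B ≅ A'⟦u, v⟧/(Q - t₁^{n₁} ⋯ t_r^{n_r})`], then we see that the complete
local ring of `T` at `x` corresponds to the quotient map `B → A'/t₁A'`. The integer `n₁` must be
`≥ 2`, otherwise `X` is regular along the generic point of `T`, in contradiction to our
assumption. This integer is independent of the choice of `x ∈ T`, i.e. it is an invariant `n_T`
of the codimension 2 irreducible component `T` of `Sing(X)`." Rendered for the curve
`f : X → Y` of a pair in Situation 4.23 over an algebraically closed field (`S = Y`) and the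
generic point `x` of `T` — a non-regular point with `dim 𝒪_{X,x} ≤ 2`
(`Scheme.singularLocusCodimLE X 2`; these are exactly the generic points of the codimension-2
components, `DeJong1996SemiStableSingCodimTwo_holds`) — with `n_T` the length of the local ring
of the singular scheme `Sing(f)` (2.21) at `x` (`Scheme.Hom.nodeThickness`, see there): it is an
integer (finite) `≥ 2`. Users take `(h : DeJong1996SemiStableThickness)`; it is a node to
decompose further (3.3, via `DeJong1996NodeLocalStructure`, and the computation of `Fitt₁`).
[cite: DeJong1996, 3.4, p. 63] -/
def DeJong1996SemiStableThickness : Prop :=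
  ∀ (k : Type u) [Field k] [IsAlgClosed k] (X Y : Scheme.{u}) (f : X ⟶ Y)
    (g : Y ⟶ Spec (.of k)) (D : Set Y) (n : ℕ) (τ : Fin n → (Y ⟶ X)),
    DeJong1996.SemiStablePair f g D τ →
      ∀ x ∈ Scheme.singularLocusCodimLE X 2,
        2 ≤ Scheme.Hom.nodeThickness f x ∧ Scheme.Hom.nodeThickness f x ≠ ⊤

open Scheme.IdealSheafData in
/-- NAMED FACT — **de Jong 1996, 3.4, the Claim, for one blow-up.** Setting 3.1, `T` an
irreducible component of `Sing(X)` of codimension `2`: "We write `φ : X' → X` for the blowing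
up of `X` in the ideal sheaf of `T`, and let `f' : X' → S` be the structural map. We claim that
(i) the center of `φ` lies in `Sing(X)`, (ii) `X'` is a semi-stable curve over `S`, smooth over
`S ∖ D`, (iii) the invariant `n_T` has dropped and (iv) if `X` is split, then so is `X'`. More
precisely, (iii) means the following: Let `T'` be an irreducible component of `Sing(X)`. There
exists at most one such irreducible component `T̃ ⊂ Sing(X')` lying above `T'`; we have
`n_T̃ = n_{T'}`, unless `T' = T` in which case we have `n_T̃ = n_T - 2`." ("This blow up is
covered by three affine charts … Chart "`t₁ ≠ 0`": `A[u, v, u', v']/(u - t₁u', v - t₁v', u'v' - t₁^{n₁-2} t₂^{n₂} ⋯ t_r^{n_r})`.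
… The "new" component `T̃` lying over `T` is given by `u' = v' = t₁ = 0`, unless `n₁ = 2, 3`,
then `T̃` lying over `T` does not exist. Clearly, `n_T` has dropped by 2.") Rendered for the
curve `f : X → Y` of a pair in Situation 4.23 over an algebraically closed field (`S = Y`; the
sections play no role), the generic point `x` of `T` (a non-regular point with
`dim 𝒪_{X,x} ≤ 2`), and ANY blowing up `π : X' → X` of `X` in the ideal sheaf of the reduced
closed subscheme `T = cl{x}` (`IsBlowup π (vanishingIdeal (closure {x}))`): (ii) `π ≫ f` is a
semi-stable curve (2.21), smooth over `Y ∖ D`; (iii) `π` maps the codimension-`≤ 2` singular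
points of `X'` (the generic points of the codimension-2 components `T̃` of `Sing(X')`) into
those of `X`, injectively (at most one `T̃` above each `T'`, each `T̃` lying above some `T'`),
preserving the thickness `n` (`Scheme.Hom.nodeThickness`) except at the point over `x`, where it
drops by `2`. (i) is automatic — a blow-up is an isomorphism off its centre `T ⊆ Sing(X)` — and
(iv) is not rendered (4.24). Users take `(h : DeJong1996SemiStableCodimTwoBlowup)`; it is a node
to decompose further (the three charts; 2.21 for `X'` via its geometric fibres; the strict
transforms of the `T' ≠ T`). [cite: DeJong1996, 3.4, pp. 63–64] -/
def DeJong1996SemiStableCodimTwoBlowup : Prop :=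
  ∀ (k : Type u) [Field k] [IsAlgClosed k] (X Y : Scheme.{u}) (f : X ⟶ Y)
    (g : Y ⟶ Spec (.of k)) (D : Set Y) (n : ℕ) (τ : Fin n → (Y ⟶ X))
    (hS : DeJong1996.SemiStablePair f g D τ),
    ∀ x ∈ Scheme.singularLocusCodimLE X 2,
      ∀ (X' : Scheme.{u}) (π : X' ⟶ X),
        IsBlowup π (vanishingIdeal ⟨closure {x}, isClosed_closure⟩) →
          IsSemiStableCurve (π ≫ f) ∧
          Smooth ((π ≫ f) ∣_ ⟨Dᶜ, hS.isStrictNormalCrossingsDivisor.isClosed.isOpen_compl⟩) ∧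
          Set.MapsTo π (Scheme.singularLocusCodimLE X' 2) (Scheme.singularLocusCodimLE X 2) ∧
          Set.InjOn π (Scheme.singularLocusCodimLE X' 2) ∧
          (∀ x' ∈ Scheme.singularLocusCodimLE X' 2, π x' ≠ x →
            Scheme.Hom.nodeThickness (π ≫ f) x' = Scheme.Hom.nodeThickness f (π x')) ∧
          (∀ x' ∈ Scheme.singularLocusCodimLE X' 2, π x' = x →
            Scheme.Hom.nodeThickness (π ≫ f) x' + 2 = Scheme.Hom.nodeThickness f x)

/-! ## The iteration along one component -/

namespace DeJong1996

namespace SemiStablePair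

variable {k : Type u} [Field k] {X Y : Scheme.{u}} {f : X ⟶ Y} {g : Y ⟶ Spec (.of k)}
  {D : Set Y} {n : ℕ} {τ : Fin n → (Y ⟶ X)}

open Scheme.IdealSheafData in
/-- The ideal sheaf of the reduced closed subscheme `cl{x}` through a non-regular point `x` of
the variety `X` is non-zero: `cl{x} ≠ X`, the generic point being regular. [folklore] -/
theorem vanishingIdeal_closure_ne_bot (hS : SemiStablePair f g D τ) {x : X}
    (hx : ¬ IsRegularLocalRing (X.presheaf.stalk x)) :
    vanishingIdeal ⟨closure ({x} : Set X), isClosed_closure⟩ ≠ ⊥ := by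
  haveI := hS.isIntegral
  intro hbot
  have hsupp : (closure ({x} : Set X)) = Set.univ := by
    have := congrArg (fun I : X.IdealSheafData => ((I.support : Closeds X) : Set X)) hbot
    simpa [coe_support_vanishingIdeal, support_bot] using this
  -- then `x` is a generic point of `X`, i.e. the generic point, which is regular
  have hgen : IsGenericPoint x (Set.univ : Set X) := by
    rw [isGenericPoint_def, hsupp]
  have hη : x = genericPoint X := hgen.eq (genericPoint_spec X)
  apply hx
  rw [hη]
  show IsRegularLocalRing X.functionField
  infer_instance

open Scheme.IdealSheafData in
/-- An open not containing `x` lies in the complement of the centre `cl{x}`. [folklore] -/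
theorem le_centreCompl_vanishingIdeal_closure {x : X} {U : X.Opens} (hxU : x ∉ U) :
    U ≤ centreCompl (vanishingIdeal ⟨closure ({x} : Set X), isClosed_closure⟩) := by
  intro y hyU hy
  have hy' : y ∈ closure ({x} : Set X) := by
    have := coe_support_vanishingIdeal (X := X) ⟨closure ({x} : Set X), isClosed_closure⟩
    have hy2 : y ∈ ((vanishingIdeal ⟨closure ({x} : Set X), isClosed_closure⟩).support : Set X) :=
      hy
    rw [this] at hy2
    exact hy2
  -- `U` is an open neighbourhood of `y ∈ cl{x}`, so it contains `x`
  have : x ∈ (U : Set X) := by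
    by_contra hxU'
    have hcl : closure ({x} : Set X) ⊆ (U : Set X)ᶜ :=
      closure_minimal (Set.singleton_subset_iff.mpr hxU') U.2.isClosed_compl
    exact hcl hy' hyU
  exact hxU this

end SemiStablePair

end DeJong1996

/-- Arithmetic of the induction on `n_T` in `ℕ∞`: `a + 2 ≤ N + 1 → a ≤ N`. [folklore] -/
theorem ENat.le_of_add_two_le_add_one {a : ℕ∞} {N : ℕ} (h : a + 2 ≤ (N : ℕ∞) + 1) :
    a ≤ N := by
  induction a using ENat.recTopCoe with
  | top => exact absurd h (by simp)
  | coe m =>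
    have h' : m + 2 ≤ N + 1 := by exact_mod_cast h
    exact_mod_cast (show m ≤ N by omega)

open Scheme.IdealSheafData in
/-- **de Jong 1996, 3.4 iterated along one component — `DeJong1996SemiStableCodimTwoModification`
from the invariant `n_T` (`DeJong1996SemiStableThickness`), the Claim for one blow-up
(`DeJong1996SemiStableCodimTwoBlowup`) and the projectivity of blow-ups
(`BlowupProjectiveOverField`, Hartshorne II 7.16 (c)).** "Clearly, the lemma follows from the
claim, by repeatedly blowing up components of the singular locus of codimension 2 in `X` and
induction on the numbers `n_T`": by induction on `n_T = n(x)`, blow up `T = cl{x}` (the blow-up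
exists, is a modification — `cl{x} ≠ X` — and is projective); it is an isomorphism over every
open `U ∌ x` (`U` misses the centre `cl{x}`). If no codimension-2 singular component of `X'`
lies over `T`, this blow-up answers. Otherwise there is exactly one, `T̃ = cl{x̃}`, with
`n(x̃) = n(x) - 2`; the curve `π ≫ f` with the lifted sections is again a pair in Situation
4.23 (`SemiStablePair.exists_lift`: the sections land in smooth opens, which miss the singular
`x`), so by induction there is a modification `ψ : X'' → X'` resolving `T̃` in the required
sense, and `ψ ≫ π` answers: it is an isomorphism over opens `U ∌ x` (`x̃ ∉ π⁻¹U`), and a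
codimension-2 singular point of `X''` maps to one of `X'` other than `x̃`, hence (injectivity
of `π` on these points) to one of `X` other than `x`. [cite: DeJong1996, 3.4, pp. 63–64] -/
theorem DeJong1996SemiStableCodimTwoModification.of_thickness_of_blowup
    (hP : BlowupProjectiveOverField.{u}) (h2 : DeJong1996SemiStableThickness.{u})
    (h3 : DeJong1996SemiStableCodimTwoBlowup.{u}) :
    DeJong1996SemiStableCodimTwoModification.{u} := by
  intro k _ _ X Y f g D n τ hS x hx₁ hx₂
  have hx : x ∈ Scheme.singularLocusCodimLE X 2 := ⟨hx₁, hx₂⟩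
  -- induction on `n_T`
  suffices H : ∀ (N : ℕ) (X : Scheme.{u}) (f : X ⟶ Y) (τ : Fin n → (Y ⟶ X))
      (hS : DeJong1996.SemiStablePair f g D τ) (x : X), x ∈ Scheme.singularLocusCodimLE X 2 →
        Scheme.Hom.nodeThickness f x ≤ N →
        ∃ (X' : Scheme.{u}) (φ : X' ⟶ X), IsModification φ ∧
          Literature.AlgebraicGeometry.Motives.IsProjectiveOver (Over.mk (φ ≫ f ≫ g)) ∧
          (∀ U : X.Opens, x ∉ U → IsIso (φ ∣_ U)) ∧
          IsSemiStableCurve (φ ≫ f) ∧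
          Smooth ((φ ≫ f) ∣_ ⟨Dᶜ, hS.isStrictNormalCrossingsDivisor.isClosed.isOpen_compl⟩) ∧
          Set.MapsTo φ (Scheme.singularLocusCodimLE X' 2)
            (Scheme.singularLocusCodimLE X 2 \ {x}) ∧
          Set.InjOn φ (Scheme.singularLocusCodimLE X' 2) by
    obtain ⟨N, hN⟩ := ENat.ne_top_iff_exists.mp (h2 k X Y f g D n τ hS x hx).2
    exact H N X f τ hS x hx hN.symm.le
  intro N
  induction N with
  | zero =>
    intro X f τ hS x hx hN
    have h2x := (h2 k X Y f g D n τ hS x hx).1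
    exact absurd (le_trans h2x hN) (by decide)
  | succ N ih =>
    intro X f τ hS x hx hN
    haveI := hS.isIntegral
    haveI := hS.isNoetherian
    -- 3.4: blow up `T = cl{x}`
    let J : X.IdealSheafData := vanishingIdeal ⟨closure ({x} : Set X), isClosed_closure⟩
    obtain ⟨X₁, π, hπ⟩ := exists_isBlowup X J
    have hJ : J ≠ ⊥ := hS.vanishingIdeal_closure_ne_bot hx.1
    have hπm : IsModification π := IsModification.of_isBlowup hπ hJ
    haveI := hπm.isIntegral
    have hproj : Literature.AlgebraicGeometry.Motives.IsProjectiveOver (Over.mk (π ≫ f ≫ g)) :=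
      hP k X X₁ (f ≫ g) J π inferInstance hS.isProjectiveOver hJ hπ
    -- (i): `π` is an isomorphism over every open missing `x`
    have hiso : ∀ U : X.Opens, x ∉ U → IsIso (π ∣_ U) := fun U hxU =>
      isIso_morphismRestrict_of_le π hπ.isIso_compl
        (DeJong1996.SemiStablePair.le_centreCompl_vanishingIdeal_closure hxU)
    -- (ii), (iii)
    obtain ⟨hss, hsm, hmaps, hinj, hsame, hdrop⟩ := h3 k X Y f g D n τ hS x hx X₁ π hπ
    by_cases hover : ∃ x₁ ∈ Scheme.singularLocusCodimLE X₁ 2, π x₁ = x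
    · -- a (unique) codimension-2 singular component `T̃ = cl{x₁}` over `T`, `n(x₁) = n(x) - 2`
      obtain ⟨x₁, hx₁, hπx₁⟩ := hover
      have hN₁ : Scheme.Hom.nodeThickness (π ≫ f) x₁ ≤ N := by
        apply ENat.le_of_add_two_le_add_one
        rw [hdrop x₁ hx₁ hπx₁]
        exact_mod_cast hN
      -- the pair upstairs (4.24: the sections lift)
      have hiso' : ∀ i, ∃ U : X.Opens, Set.range (τ i) ⊆ (U : Set X) ∧ Smooth (U.ι ≫ f) ∧
          IsIso (π ∣_ U) := fun i => by
        obtain ⟨U, hU, hUf⟩ := hS.exists_smooth i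
        exact ⟨U, hU, hUf, hiso U (hS.notMem_of_smooth hUf hx.1)⟩
      obtain ⟨τ₁, -, hS₁, -⟩ := hS.exists_lift hproj hiso' hss hsm
      -- induction
      obtain ⟨X', ψ, hψ, hproj', hisoψ, hss', hsm', hmaps', hinj'⟩ :=
        ih X₁ (π ≫ f) τ₁ hS₁ x₁ hx₁ hN₁
      refine ⟨X', ψ ≫ π, hψ.comp hπm, ?_, fun U hxU => ?_, ?_, ?_, ?_, ?_⟩
      · simpa only [Category.assoc] using hproj'
      · -- `x₁ ∉ π⁻¹ U`
        rw [morphismRestrict_comp]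
        haveI h₁ : IsIso (π ∣_ U) := hiso U hxU
        have hx₁U : x₁ ∉ π ⁻¹ᵁ U := fun h => hxU (by simpa [hπx₁] using h)
        have h₂ : IsIso (ψ ∣_ π ⁻¹ᵁ U) := hisoψ _ hx₁U
        exact @IsIso.comp_isIso _ _ _ _ _ _ _ h₂ h₁
      · simpa only [Category.assoc] using hss'
      · rw [Category.assoc]
        exact hsm'
      · intro x' hx'
        have h1 : ψ x' ∈ Scheme.singularLocusCodimLE X₁ 2 \ {x₁} := hmaps' hx'
        refine ⟨?_, ?_⟩
        · rw [Scheme.Hom.comp_apply]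
          exact hmaps h1.1
        · intro heq
          rw [Set.mem_singleton_iff, Scheme.Hom.comp_apply] at heq
          exact h1.2 (hinj h1.1 hx₁ (heq.trans hπx₁.symm))
      · intro x' hx' x'' hx'' heq
        simp only [Scheme.Hom.comp_apply] at heq
        exact hinj' hx' hx'' (hinj (hmaps' hx').1 (hmaps' hx'').1 heq)
    · -- no codimension-2 singular component over `T`: the blow-up itself answers
      push Not at hover
      exact ⟨X₁, π, hπm, hproj, hiso, hss, hsm, fun x₁ hx₁ => ⟨hmaps hx₁, hover x₁ hx₁⟩, hinj⟩

/-- **de Jong 1996, Lemma 3.2 from the invariant `n_T` and the Claim of 3.4** (and the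
projectivity of blow-ups). [cite: DeJong1996, 3.2–3.4, pp. 62–64] -/
theorem DeJong1996Lemma32.of_thickness_of_blowup (hP : BlowupProjectiveOverField.{u})
    (h2 : DeJong1996SemiStableThickness.{u}) (h3 : DeJong1996SemiStableCodimTwoBlowup.{u}) :
    DeJong1996Lemma32.{u} :=
  DeJong1996Lemma32.of_codimTwoModification
    (DeJong1996SemiStableCodimTwoModification.of_thickness_of_blowup hP h2 h3)

/-- `DeJong1996SemiStableCodimThree` (4.24, first sentence) from the invariant `n_T`, the Claim
of 3.4 and the projectivity of blow-ups. [cite: DeJong1996, 3.2–3.4 and 4.24, pp. 62–64, 75] -/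
theorem DeJong1996SemiStableCodimThree.of_thickness_of_blowup (hP : BlowupProjectiveOverField.{u})
    (h2 : DeJong1996SemiStableThickness.{u}) (h3 : DeJong1996SemiStableCodimTwoBlowup.{u}) :
    DeJong1996SemiStableCodimThree.{u} :=
  DeJong1996SemiStableCodimThree.of_codimTwoModification
    (DeJong1996SemiStableCodimTwoModification.of_thickness_of_blowup hP h2 h3)

end Literature.AlgebraicGeometry.Resolution

end
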